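import Literature.NumberTheory.Transcendental.KaehlerHodgeSmoothProofs
import Literature.NumberTheory.Transcendental.KaehlerHodgeHarmonicProofs
import Literature.NumberTheory.Transcendental.ComplexFormsProofs
import HarnessLib

/-!
# Harmonic Hodge decomposition `ℋᵏ_ℂ = ⨆ ℋ^{p,q}`: linearity of `Δ_d` and reduction to the Kähler identity (Voisin 2002, Cor. 6.10)

Theorems-only companion file of `Literature/NumberTheory/Transcendental/KaehlerHodge.lean` (C12),
accompanying its named fact
`Literature.NumberTheory.Transcendental.charmonicForms_eq_iSup_dolbeaultHarmonicForms`
("on a Kähler manifold `ℋᵏ_ℂ = ⨆_{p+q=k} ℋ^{p,q}`", the spanning half of the harmonic Hodge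
decomposition). The source is Voisin (2002), §6.1.2, Cor. 6.10 (p. 142):
`ℋ^k(X) = ⊕_{p+q=k} ℋ^{p,q}`, where `ℋ^{p,q}` is the set of forms of type `(p,q)` harmonic for
`Δ_d`, "by theorem 6.7 also the set of forms of type `(p,q)` which are harmonic for `Δ_∂̄`".
The printed proof is an assembly of three results:

* Thm. 6.7 (p. 141), the **Kähler identity** `Δ_∂ = Δ_∂̄ = ½ Δ_d` — the named fact
  `cHodgeLaplacian_eq_two_smul_dolbeaultLaplacian` of `KaehlerHodge.lean` (from Prop. 6.5,
  `[Λ, ∂̄] = -i∂*`; the deep input, not in the tree);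
* Cor. 6.8/6.9 (p. 142), `Δ_d` is bihomogeneous, so the `(p,q)`-components of a harmonic form
  are harmonic — the named fact `typeComponent_mem_charmonicForms`;
* Warner (1983), 6.1/Def. 6.7: `Δ_d` is a linear operator on smooth forms, so the harmonic forms
  already form a subspace (membership in the span `charmonicForms` is being harmonic) — the named
  fact `mem_charmonicForms_iff`, **proved here for every smooth metric**
  (`mem_charmonicForms_iff_of_contMDiffMetric`).

## Contents

* §1 (any fibrewise metric, unconditional algebra): `δ` and `Δ_d` commute with complex scalars
  (`cmcoderiv_smul`, `cHodgeLaplacian_smul`), kill `0`, and scalar multiples of `Δ_d`-harmonic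
  forms are harmonic.
* §2 (smooth metric: `[IsManifold 𝓘(ℝ, E) ∞ M]`,
  `[IsContMDiffRiemannianBundle 𝓘(ℝ, E) ∞ E (TangentSpace 𝓘(ℝ, E))]`): the complexified
  codifferential of a smooth form is smooth (`IsSmoothForm.cmcoderiv`, from
  `IsSmoothForm.cHodgeStar` of `KaehlerHodgeSmoothProofs.lean` and `isSmoothForm_mextDeriv`),
  `δ` and `Δ_d` are additive on smooth forms (`cmcoderiv_add`, `cHodgeLaplacian_add`), and hence
  the over-general named fact `mem_charmonicForms_iff o` of `KaehlerHodge.lean` holds **in the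
  presence of the intended instances** (`mem_charmonicForms_iff_of_contMDiffMetric`) — exactly
  parallel to `hodgeLaplacian_add`, `mem_harmonicForms_iff_of_contMDiffMetric` of
  `Geometry/Kaehler/RiemannianHodgeSmoothProofs.lean`. (Like its real sibling, this
  `def … : Prop` does not bind the smooth-metric section instances its docstring assumes —
  `#check @mem_charmonicForms_iff` lists only `[RiemannianBundle _]` — so only this
  instance-qualified form can be proved; cf. `RiemannianHodgeHarmonicRefutation.lean` for the
  real case and `KaehlerHodgeSmoothProofs.lean`, §*Correction*, for `isSmoothForm_cHodgeStar`.)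
* §3 the **relative discharge** `charmonicForms_eq_iSup_dolbeaultHarmonicForms_of_facts`
  (pattern of `mem_harmonicForms_iff_of_facts`, `RiemannianHodgeHarmonic.lean`, and of
  `mk_mem_hodgePQ_of_mem_dolbeaultHarmonicForms_of`, `Motives/HodgeDecompositionProofs.lean`):
  from the two deep facts (Thm. 6.7 as `hK`, Cor. 6.9 as `hT`), the linearity of §2 at the smooth
  metric `g` and the discharged type decomposition `α = ∑ α^{p,q}`
  (`sum_antidiagonal_typeComponent_holds`, `isOfType_typeComponent_holds`), the fact follows:
  `⊇`: a generator `α` of `ℋ^{p,q}` is smooth with `Δ_∂̄ α = 0`, so `Δ_d α = 2 • Δ_∂̄ α = 0`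
  (this half is `dolbeaultHarmonicForms_le_charmonicForms_of_laplacian_comparison` of
  `KaehlerHodgeHarmonicProofs.lean`, Voisin's remark after Cor. 6.10);
  `⊆`: a generator `α` of `ℋᵏ_ℂ` is smooth with `Δ_d α = 0`, `α = ∑ α^{p,q}`, each `α^{p,q}` is in
  `ℋᵏ_ℂ` (Cor. 6.9), i.e. smooth with `Δ_d α^{p,q} = 0` (linearity), so `Δ_∂̄ α^{p,q} = 0`
  (Thm. 6.7, `2 ≠ 0`) and `α^{p,q}` has type `(p,q)`: `α^{p,q} ∈ ℋ^{p,q}`.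

*Remark on the upstream statements.* `hK`, `hT` are `def … : Prop`s of `KaehlerHodge.lean` written
after a section `variable [IsManifold 𝓘(ℂ, E) ω M]` which their bodies do not use, so (like the
fact proved here) the `Prop`s carry no holomorphic-atlas hypothesis; their eventual discharges
will bind that instance (as `isSmoothForm_typeComponent_holds` does), and the closed discharge
`charmonicForms_eq_iSup_dolbeaultHarmonicForms_holds` is then this theorem fed the two. No new
named fact is introduced (D-0026); nothing in this file is deep.

## References

* C. Voisin, *Hodge Theory and Complex Algebraic Geometry I*, Cambridge Studies in Advanced
  Mathematics 76 (2002), §5.1.2 (complex-valued forms, `Δ_d` on `A^k_ℂ`), §6.1.2: Thm. 6.7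
  (p. 141), Cor. 6.8, 6.9, 6.10 (p. 142). [Voisin2002]
* F. W. Warner, *Foundations of Differentiable Manifolds and Lie Groups*, GTM 94 (1983), 4.10 (6)
  (p. 150), 6.1 and Def. 6.7 (pp. 220–222). [WarnerGTM94]
* D. Huybrechts, *Complex Geometry* (2005), Prop. 3.1.12, Thm. 3.2.8, Cor. 3.2.12.
-/

noncomputable section

open scoped Manifold ContDiff Topology
open Bundle Module Set Finset

namespace Literature.NumberTheory.Transcendental

open Literature.Geometry.Kaehler

variable {E : Type*} [NormedAddCommGroup E] [NormedSpace ℂ E]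
  {M : Type*} [TopologicalSpace M] [ChartedSpace E M] {k m : ℕ}
  [FiniteDimensional ℂ E] {n : ℕ} [Fact (finrank ℝ E = n)]

/-! ### §1 Unconditional algebra of `δ` and `Δ_d` (any fibrewise metric) -/

section Algebra

variable [RiemannianBundle (fun x : M ↦ TangentSpace 𝓘(ℝ, E) x)]
  (o : (x : M) → Orientation ℝ (TangentSpace 𝓘(ℝ, E) x) (Fin n))

/-- The complexified codifferential commutes with complex scalars, with no smoothness hypothesis
(`⋆` is `ℂ`-linear and `d (c • α) = c • dα` unconditionally, `mextDeriv_smul_complex_holds`).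
Voisin (2002), §5.1.2; Warner (1983), 6.1. [cite: Voisin2002, §5.1.2] -/
theorem cmcoderiv_smul (h : (k + 1) + m = n) (c : ℂ) (α : MForm 𝓘(ℝ, E) M ℂ (k + 1)) :
    cmcoderiv o h (c • α) = c • cmcoderiv o h α := by
  simp only [cmcoderiv, map_smul, mextDeriv_smul_complex_holds c]
  rw [smul_comm]

/-- `δ 0 = 0`. [folklore] -/
@[simp]
theorem cmcoderiv_zero (h : (k + 1) + m = n) :
    cmcoderiv o h (0 : MForm 𝓘(ℝ, E) M ℂ (k + 1)) = 0 := by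
  simpa using cmcoderiv_smul o h 0 0

/-- The complexified Hodge–de Rham Laplacian commutes with complex scalars, with no smoothness
hypothesis: `Δ_d (c • α) = c • Δ_d α`. Voisin (2002), §5.1.2; Warner (1983), 6.1. [cite: Voisin2002, §5.1.2] -/
theorem cHodgeLaplacian_smul (h : k + m = n) (c : ℂ) (α : MForm 𝓘(ℝ, E) M ℂ k) :
    cHodgeLaplacian o k m h (c • α) = c • cHodgeLaplacian o k m h α := by
  rcases k with - | k <;> rcases m with - | m
  · simp [cHodgeLaplacian]
  · simp only [cHodgeLaplacian, mextDeriv_smul_complex_holds c, cmcoderiv_smul]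
  · simp only [cHodgeLaplacian, cmcoderiv_smul, mextDeriv_smul_complex_holds c]
  · simp only [cHodgeLaplacian, mextDeriv_smul_complex_holds c, cmcoderiv_smul, smul_add]

/-- `Δ_d 0 = 0`. [folklore] -/
@[simp]
theorem cHodgeLaplacian_zero (h : k + m = n) :
    cHodgeLaplacian o k m h (0 : MForm 𝓘(ℝ, E) M ℂ k) = 0 := by
  simpa using cHodgeLaplacian_smul o h 0 0

/-- The zero form is `Δ_d`-harmonic. [folklore] -/
theorem isCHarmonicForm_zero (h : k + m = n) : IsCHarmonicForm o h (0 : MForm 𝓘(ℝ, E) M ℂ k) :=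
  ⟨isSmoothForm_zero, cHodgeLaplacian_zero o h⟩

/-- Complex multiples of `Δ_d`-harmonic forms are `Δ_d`-harmonic (unconditionally).
Warner (1983), 6.1 / Def. 6.7. [cite: WarnerGTM94, 6.1 and Def. 6.7] -/
theorem IsCHarmonicForm.smul (h : k + m = n) {α : MForm 𝓘(ℝ, E) M ℂ k}
    (hα : IsCHarmonicForm o h α) (c : ℂ) : IsCHarmonicForm o h (c • α) :=
  ⟨hα.1.smul_complex c, by rw [cHodgeLaplacian_smul, hα.2, smul_zero]⟩

/-- `Δ_d`-harmonic forms belong to `charmonicForms` (the easy inclusion). [folklore] -/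
theorem IsCHarmonicForm.mem_charmonicForms {h : k + m = n} {α : MForm 𝓘(ℝ, E) M ℂ k}
    (hα : IsCHarmonicForm o h α) : α ∈ charmonicForms o h :=
  Submodule.subset_span hα

end Algebra

/-! ### §2 Smooth metric: smoothness of `δ`; additivity of `δ`, `Δ_d`; `mem_charmonicForms_iff` -/

section SmoothMetric

variable [IsManifold 𝓘(ℝ, E) ∞ M] [RiemannianBundle (fun x : M ↦ TangentSpace 𝓘(ℝ, E) x)]
  [IsContMDiffRiemannianBundle 𝓘(ℝ, E) ∞ E (fun x : M ↦ TangentSpace 𝓘(ℝ, E) x)]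
  (o : (x : M) → Orientation ℝ (TangentSpace 𝓘(ℝ, E) x) (Fin n))

/-- **The complexified codifferential of a smooth form is smooth** (smooth metric):
`δ = ± ⋆ d ⋆` is a composite of `⋆` (`IsSmoothForm.cHodgeStar`), `d` (`isSmoothForm_mextDeriv`, fed
the discharged chart-independence fact `inChart_mextDeriv_holds`) and a sign.
Warner (1983), 6.1 (2), p. 220. [cite: WarnerGTM94, 6.1 (2), p. 220] -/
theorem _root_.Literature.Geometry.Kaehler.IsSmoothForm.cmcoderiv
    (ho : IsSmoothForm (riemannianVolumeForm o)) (h : (k + 1) + m = n)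
    {α : MForm 𝓘(ℝ, E) M ℂ (k + 1)} (hα : IsSmoothForm α) : IsSmoothForm (cmcoderiv o h α) :=
  (IsSmoothForm.cHodgeStar o ho _ (isSmoothForm_mextDeriv (inChart_mextDeriv_holds 𝓘(ℝ, E) M ℂ)
    (IsSmoothForm.cHodgeStar o ho h hα))).smul_complex _

/-- **The codifferential is additive on smooth forms** (smooth metric): `δ(α + β) = δα + δβ`
(`⋆` is additive, and `d` is additive on the smooth forms `⋆α`, `⋆β`, `mextDeriv_add`).
Warner (1983), 6.1, p. 220. [cite: WarnerGTM94, 6.1, p. 220] -/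
theorem cmcoderiv_add (ho : IsSmoothForm (riemannianVolumeForm o)) (h : (k + 1) + m = n)
    {α β : MForm 𝓘(ℝ, E) M ℂ (k + 1)} (hα : IsSmoothForm α) (hβ : IsSmoothForm β) :
    cmcoderiv o h (α + β) = cmcoderiv o h α + cmcoderiv o h β := by
  simp only [cmcoderiv, map_add, mextDeriv_add (IsSmoothForm.cHodgeStar o ho h hα)
    (IsSmoothForm.cHodgeStar o ho h hβ), smul_add]

/-- **Additivity of the complexified Hodge–de Rham Laplacian on smooth forms** for a smooth
metric: `Δ_d (α + β) = Δ_d α + Δ_d β` — Warner's "`Δ` is a linear operator on `E^p(M)`"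
(1983, 6.1, p. 220), here on `A^k_ℂ = A^k ⊗ ℂ` (Voisin (2002), §5.1.2) — case by case on the
degree pattern `(k, m)` of the definition. [cite: WarnerGTM94, 6.1, p. 220] -/
theorem cHodgeLaplacian_add (ho : IsSmoothForm (riemannianVolumeForm o)) (h : k + m = n)
    {α β : MForm 𝓘(ℝ, E) M ℂ k} (hα : IsSmoothForm α) (hβ : IsSmoothForm β) :
    cHodgeLaplacian o k m h (α + β) = cHodgeLaplacian o k m h α + cHodgeLaplacian o k m h β := by
  have hd : inChart_mextDeriv 𝓘(ℝ, E) M ℂ := inChart_mextDeriv_holds 𝓘(ℝ, E) M ℂ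
  rcases k with - | k <;> rcases m with - | m
  · simp [cHodgeLaplacian]
  · simp only [cHodgeLaplacian]
    rw [mextDeriv_add hα hβ, cmcoderiv_add o ho _ (isSmoothForm_mextDeriv hd hα)
      (isSmoothForm_mextDeriv hd hβ)]
  · simp only [cHodgeLaplacian]
    rw [cmcoderiv_add o ho _ hα hβ, mextDeriv_add (IsSmoothForm.cmcoderiv o ho _ hα)
      (IsSmoothForm.cmcoderiv o ho _ hβ)]
  · simp only [cHodgeLaplacian]
    rw [cmcoderiv_add o ho h hα hβ, mextDeriv_add (IsSmoothForm.cmcoderiv o ho h hα)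
      (IsSmoothForm.cmcoderiv o ho h hβ),
      mextDeriv_add hα hβ, cmcoderiv_add o ho _ (isSmoothForm_mextDeriv hd hα)
      (isSmoothForm_mextDeriv hd hβ)]
    abel

/-- Sums of `Δ_d`-harmonic forms are `Δ_d`-harmonic (smooth metric). Warner (1983), 6.1 /
Def. 6.7. [cite: WarnerGTM94, 6.1 and Def. 6.7] -/
theorem IsCHarmonicForm.add (ho : IsSmoothForm (riemannianVolumeForm o)) (h : k + m = n)
    {α β : MForm 𝓘(ℝ, E) M ℂ k} (hα : IsCHarmonicForm o h α) (hβ : IsCHarmonicForm o h β) :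
    IsCHarmonicForm o h (α + β) :=
  ⟨hα.1.add hβ.1, by rw [cHodgeLaplacian_add o ho h hα.1 hβ.1, hα.2, hβ.2, add_zero]⟩

/-- **`mem_charmonicForms_iff` for a smooth metric.** In the presence of the intended instances
(`IsManifold 𝓘(ℝ, E) ∞ M`, smooth metric `IsContMDiffRiemannianBundle 𝓘(ℝ, E) ∞`), the
over-general named fact `mem_charmonicForms_iff o` of `KaehlerHodge.lean` holds: membership in
the span `charmonicForms o h` is being `Δ_d`-harmonic, since the carrier is already a
`ℂ`-subspace (`isCHarmonicForm_zero`, `IsCHarmonicForm.add`, `IsCHarmonicForm.smul`).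
Warner (1983), 6.1 and Def. 6.7, pp. 220–222; Voisin (2002), §5.1.2. [cite: WarnerGTM94, 6.1 and Def. 6.7] -/
theorem mem_charmonicForms_iff_of_contMDiffMetric : mem_charmonicForms_iff (k := k) (m := m) o := by
  intro ho h α
  refine ⟨fun hα ↦ ?_, fun hα ↦ hα.mem_charmonicForms o⟩
  induction hα using Submodule.span_induction with
  | mem x hx => exact hx
  | zero => exact isCHarmonicForm_zero o h
  | add x y _ _ hx hy => exact hx.add o ho h hy
  | smul c x _ hx => exact hx.smul o h c

end SmoothMetric

/-! ### §3 The harmonic Hodge decomposition from the Kähler identity -/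

section Kaehler

variable [IsManifold 𝓘(ℝ, E) ∞ M]
  (g : ContMDiffRiemannianMetric 𝓘(ℝ, E) ∞ E (fun x : M ↦ TangentSpace 𝓘(ℝ, E) x))
  (o : (x : M) → Orientation ℝ (TangentSpace 𝓘(ℝ, E) x) (Fin n))

/-- **Harmonic Hodge decomposition from the Kähler identity** (relative discharge of the named fact
`charmonicForms_eq_iSup_dolbeaultHarmonicForms`): on a Kähler manifold `(M, g)`,
`ℋᵏ_ℂ = ⨆_{p+q=k} ℋ^{p,q}`, *assuming* the Kähler identity `Δ_d = 2Δ_∂̄` on smooth forms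
(`hK`, Voisin (2002), Thm. 6.7) and type preservation of `Δ_d` (`hT`, Cor. 6.8/6.9); the third
ingredient of the printed proof, linearity of `Δ_d` on smooth forms (Warner (1983), 6.1), is
`mem_charmonicForms_iff_of_contMDiffMetric` at the smooth metric `g`. This is the assembly
printed as the proof of Voisin (2002), Cor. 6.10, p. 142, using the type decomposition
`α = ∑_{p+q=k} α^{p,q}` (`sum_antidiagonal_typeComponent_holds`) and
`isOfType_typeComponent_holds`. [cite: Voisin2002, §6.1.2 Cor. 6.10 (p. 142)] -/
theorem charmonicForms_eq_iSup_dolbeaultHarmonicForms_of_facts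
    (hK : cHodgeLaplacian_eq_two_smul_dolbeaultLaplacian (k := k) (m := m) g o)
    (hT : typeComponent_mem_charmonicForms (k := k) (m := m) g o) :
    charmonicForms_eq_iSup_dolbeaultHarmonicForms (k := k) (m := m) g o := by
  intro hg h
  letI : RiemannianBundle (fun x : M ↦ TangentSpace 𝓘(ℝ, E) x) := ⟨g.toRiemannianMetric⟩
  intro ho
  have hW : mem_charmonicForms_iff (k := k) (m := m) o :=
    mem_charmonicForms_iff_of_contMDiffMetric o
  apply le_antisymm
  · -- `ℋᵏ_ℂ ≤ ⨆ ℋ^{p,q}`: Cor. 6.9 on the generators, then Thm. 6.7.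
    rw [charmonicForms, Submodule.span_le]
    intro α hα
    have hsum : ∑ pq ∈ antidiagonal k, α.typeComponent pq.1 pq.2 = α :=
      sum_antidiagonal_typeComponent_holds α
    rw [Set.mem_setOf_eq] at hα
    rw [SetLike.mem_coe, ← hsum]
    refine Submodule.sum_mem _ fun pq hpq ↦ ?_
    refine Submodule.mem_iSup_of_mem pq (Submodule.mem_iSup_of_mem hpq ?_)
    apply Submodule.subset_span
    have hmem : α.typeComponent pq.1 pq.2 ∈ charmonicForms o h :=
      hT hg h pq.1 pq.2 ho (hα.mem_charmonicForms o)
    have hc : IsCHarmonicForm o h (α.typeComponent pq.1 pq.2) := (hW ho h _).mp hmem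
    refine ⟨hc.1, isOfType_typeComponent_holds (mem_antidiagonal.mp hpq) α, ?_⟩
    have h2 := hK hg h hc.1 ho
    rw [hc.2] at h2
    exact (smul_eq_zero.mp h2.symm).resolve_left two_ne_zero
  · -- `⨆ ℋ^{p,q} ≤ ℋᵏ_ℂ`: Thm. 6.7 on the generators
    -- (`dolbeaultHarmonicForms_le_charmonicForms_of_laplacian_comparison`).
    exact iSup₂_le fun pq _ ↦
      dolbeaultHarmonicForms_le_charmonicForms_of_laplacian_comparison g o hK hg h pq.1 pq.2 ho

end Kaehler

end Literature.NumberTheory.Transcendental
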